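import Mathlib.LinearAlgebra.Matrix.DotProduct
import Mathlib.LinearAlgebra.Matrix.Symmetric
import Mathlib.Topology.Instances.Matrix
import Mathlib.Topology.MetricSpace.ProperSpace.Real
import Mathlib.Topology.Order.Compact
import Mathlib.Analysis.Normed.Module.FiniteDimension
import Mathlib.Algebra.Order.ToIntervalMod
import HarnessLib

/-!
# Uniform invertibility of the block interpolation `(1 - t) M(θ) + t D`

Topic `Analysis/Matrix`; namespace `Literature.Analysis.Matrix`.  Theorems only; no named fact,
no `sorry`.  Let `M(θ)` be a continuous, `P`-periodic family of symmetric real `3 × 3` matrices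
in block form `M = M⁺ ⊕ (m₃₃)` with `M⁺ > 0` (on `x₃ = 0`) and `m₃₃ < 0`, and let
`D = diag(1, 1, -2)` (the matrix of Honda's model `ω_A`).  Then every interpolant
`A(θ, t) = (1 - t) M(θ) + t D`, `t ∈ [0, 1]`, has the same block form and is invertible, and by
periodicity and compactness there is ONE `m > 0` with `|A(θ, t) x|² ≥ m |x|²` for all `θ`, `t`,
`x` (`exists_lower_bound_blockInterpolation`).  This is the convexity step "`S⁺ ⊕ S⁻` positive-
and negative-definite, hence `(1 - s) S + s D` non-degenerate" of Perutz 2006, proof of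
Lemma 3.1, made quantitative.

## References

* T. Perutz, *Zero-sets of near-symplectic forms*, J. Symplectic Geom. 4 (2006), §3, proof of
  Lemma 3.1. [Perutz2006]
-/

noncomputable section

open Set Filter
open scoped Matrix Topology

namespace Literature.Analysis.Matrix

open _root_.Matrix

/-- The squared Euclidean length `Σ xₖ²` of `x : Fin 3 → ℝ`. [folklore] -/
theorem sum_sq_nonneg (x : Fin 3 → ℝ) : 0 ≤ ∑ k, x k ^ 2 :=
  Finset.sum_nonneg fun k _ ↦ sq_nonneg (x k)

/-- `Σ xₖ² = 0` iff `x = 0`. [folklore] -/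
theorem sum_sq_eq_zero_iff (x : Fin 3 → ℝ) : ∑ k, x k ^ 2 = 0 ↔ x = 0 := by
  constructor
  · intro h
    funext k
    have := (Finset.sum_eq_zero_iff_of_nonneg fun k _ ↦ sq_nonneg (x k)).1 h k (Finset.mem_univ k)
    exact pow_eq_zero_iff (n := 2) (by norm_num) |>.1 this
  · rintro rfl; simp

/-- Scaling of the squared length. [folklore] -/
theorem sum_sq_smul (c : ℝ) (x : Fin 3 → ℝ) : ∑ k, (c • x) k ^ 2 = c ^ 2 * ∑ k, x k ^ 2 := by
  simp only [Pi.smul_apply, smul_eq_mul, mul_pow, Finset.mul_sum]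

variable {M : ℝ → Matrix (Fin 3) (Fin 3) ℝ}

/-- **Pointwise invertibility of the block interpolant**: if `M` is symmetric, in block form with
`M⁺ > 0` and `m₃₃ < 0`, then `((1 - t) M + t D) x = 0` forces `x = 0` for `t ∈ [0, 1]`.
[cite: Perutz2006, §3 (proof of Lemma 3.1)] -/
theorem blockInterpolation_mulVec_eq_zero {Mθ : Matrix (Fin 3) (Fin 3) ℝ} (hsymm : Mθ.IsSymm)
    (hblock : ∀ m : Fin 3, Mθ m 2 = if m = 2 then Mθ 2 2 else 0) (hneg : Mθ 2 2 < 0)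
    (hpos : ∀ v : Fin 3 → ℝ, v 2 = 0 → v ≠ 0 → 0 < v ⬝ᵥ Mθ *ᵥ v) {t : ℝ} (ht : t ∈ Icc (0 : ℝ) 1)
    {x : Fin 3 → ℝ}
    (hx : ((1 - t) • Mθ + t • Matrix.diagonal ![(1 : ℝ), 1, -2]) *ᵥ x = 0) : x = 0 := by
  have hrow : ∀ m : Fin 3, Mθ 2 m = if m = 2 then Mθ 2 2 else 0 := fun m ↦ by
    have h1 : Mθ 2 m = Mθ m 2 := by
      conv_lhs => rw [← hsymm]
      rfl
    rw [h1, hblock m]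
  have h20 : Mθ 2 0 = 0 := by simpa using hrow 0
  have h21 : Mθ 2 1 = 0 := by simpa using hrow 1
  -- third row: `((1 - t) m₃₃ - 2 t) x₃ = 0`
  have h3 : (1 - t) * Mθ 2 2 + -(t * 2) = 0 ∨ x 2 = 0 := by
    have := congrFun hx 2
    simpa [Matrix.mulVec, dotProduct, Fin.sum_univ_three, Matrix.diagonal, h20, h21] using this
  have hcoef : (1 - t) * Mθ 2 2 + -(t * 2) < 0 := by
    rcases eq_or_lt_of_le ht.1 with h0 | h0
    · rw [← h0]; simpa using hneg
    · nlinarith [ht.2, hneg]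
  have hx2 : x 2 = 0 := h3.resolve_left hcoef.ne
  -- first two rows: `(1 - t) xᵀ M x + t |x|² = 0` with `x₃ = 0`
  have hq : x ⬝ᵥ (((1 - t) • Mθ + t • Matrix.diagonal ![(1 : ℝ), 1, -2]) *ᵥ x) = 0 := by
    rw [hx, dotProduct_zero]
  rw [Matrix.add_mulVec, Matrix.smul_mulVec, Matrix.smul_mulVec, dotProduct_add,
    dotProduct_smul, dotProduct_smul] at hq
  have hdiag : x ⬝ᵥ (Matrix.diagonal ![(1 : ℝ), 1, -2] *ᵥ x) = ∑ k, x k ^ 2 := by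
    simp [dotProduct, Matrix.mulVec_diagonal, Fin.sum_univ_three, hx2]; ring
  rw [hdiag, smul_eq_mul, smul_eq_mul] at hq
  by_contra hne
  have hp : 0 < x ⬝ᵥ Mθ *ᵥ x := hpos x hx2 hne
  have hs : 0 < ∑ k, x k ^ 2 :=
    lt_of_le_of_ne (sum_sq_nonneg x) fun h ↦ hne ((sum_sq_eq_zero_iff x).1 h.symm)
  rcases eq_or_lt_of_le ht.1 with h0 | h0
  · rw [← h0] at hq; simp at hq; linarith
  · nlinarith [ht.2]

/-- **Uniform lower bound for the block interpolation** along a continuous periodic block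
family: `m Σ xₖ² ≤ Σ ((A(θ,t) x)ₖ)²` with one `m > 0`, `A(θ, t) = (1 - t) M(θ) + t D`.
[cite: Perutz2006, §3 (proof of Lemma 3.1)] -/
theorem exists_lower_bound_blockInterpolation (hMc : ∀ i j, Continuous fun θ ↦ M θ i j)
    {P : ℝ} (hP : 0 < P) (hMP : ∀ θ, M (θ + P) = M θ) (hsymm : ∀ θ, (M θ).IsSymm)
    (hblock : ∀ θ (m : Fin 3), M θ m 2 = if m = 2 then M θ 2 2 else 0) (hneg : ∀ θ, M θ 2 2 < 0)
    (hpos : ∀ θ (v : Fin 3 → ℝ), v 2 = 0 → v ≠ 0 → 0 < v ⬝ᵥ M θ *ᵥ v) :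
    ∃ m : ℝ, 0 < m ∧ ∀ θ, ∀ t ∈ Icc (0 : ℝ) 1, ∀ x : Fin 3 → ℝ,
      m * ∑ k, x k ^ 2 ≤
        ∑ k, ((((1 - t) • M θ + t • Matrix.diagonal ![(1 : ℝ), 1, -2]) *ᵥ x) k) ^ 2 := by
  -- the continuous function on the compact parameter set
  set A : ℝ × ℝ → Matrix (Fin 3) (Fin 3) ℝ := fun p ↦
    (1 - p.2) • M p.1 + p.2 • Matrix.diagonal ![(1 : ℝ), 1, -2] with hA
  set f : (ℝ × ℝ) × (Fin 3 → ℝ) → ℝ := fun p ↦ ∑ k, ((A p.1 *ᵥ p.2) k) ^ 2 with hf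
  have hMc' : Continuous M := continuous_pi fun i ↦ continuous_pi fun j ↦ hMc i j
  have hAc : Continuous A := by
    refine ((continuous_const.sub continuous_snd).smul (hMc'.comp continuous_fst)).add
      (continuous_snd.smul continuous_const)
  have hfc : Continuous f := by
    refine continuous_finsetSum _ fun k _ ↦ ?_
    refine (Continuous.pow ?_ 2)
    have h1 : Continuous fun p : (ℝ × ℝ) × (Fin 3 → ℝ) ↦ A p.1 *ᵥ p.2 :=
      (hAc.comp continuous_fst).matrix_mulVec continuous_snd
    exact (continuous_apply k).comp h1
  set S : Set (Fin 3 → ℝ) := {x | ∑ k, x k ^ 2 = 1} with hS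
  have hSc : IsCompact S := by
    refine Metric.isCompact_of_isClosed_isBounded ?_ ?_
    · exact isClosed_eq (continuous_finsetSum _ fun k _ ↦ (continuous_apply k).pow 2)
        continuous_const
    · refine (Metric.isBounded_iff_subset_closedBall 0).2 ⟨1, fun x hx ↦ ?_⟩
      rw [mem_closedBall_zero_iff, pi_norm_le_iff_of_nonneg zero_le_one]
      intro k
      rw [Real.norm_eq_abs, ← sq_le_one_iff_abs_le_one]
      have hle : x k ^ 2 ≤ ∑ j, x j ^ 2 :=
        Finset.single_le_sum (fun j _ ↦ sq_nonneg (x j)) (Finset.mem_univ k)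
      rw [hx] at hle; exact hle
  set K : Set ((ℝ × ℝ) × (Fin 3 → ℝ)) := (Icc 0 P ×ˢ Icc 0 1) ×ˢ S with hK
  have hKc : IsCompact K := (isCompact_Icc.prod isCompact_Icc).prod hSc
  -- `f > 0` on `K`
  have hfpos : ∀ p ∈ K, 0 < f p := by
    rintro ⟨⟨θ, t⟩, x⟩ ⟨⟨-, ht⟩, hx⟩
    simp only [hf]
    refine lt_of_le_of_ne (sum_sq_nonneg _) fun h0 ↦ ?_
    have hz : A (θ, t) *ᵥ x = 0 := (sum_sq_eq_zero_iff _).1 h0.symm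
    have := blockInterpolation_mulVec_eq_zero (hsymm θ) (hblock θ) (hneg θ) (hpos θ) ht hz
    rw [this] at hx
    simp [hS] at hx
  -- the minimum on `K` (if `K` is empty any positive constant works, but `K ≠ ∅`)
  have hKne : K.Nonempty := ⟨((0, 0), Pi.single 0 1), ⟨⟨⟨le_rfl, hP.le⟩, ⟨le_rfl, zero_le_one⟩⟩,
    by simp [hS, Fin.sum_univ_three]⟩⟩
  obtain ⟨p₀, hp₀K, hp₀min⟩ := hKc.exists_isMinOn hKne hfc.continuousOn
  refine ⟨f p₀, hfpos p₀ hp₀K, fun θ t ht x ↦ ?_⟩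
  -- reduce `θ` into `[0, P]`
  set k : ℤ := toIcoDiv hP 0 θ with hk
  set θ' : ℝ := θ - k • P with hθ'
  have hθ'I : θ' ∈ Icc 0 P := by
    have h := sub_toIcoDiv_zsmul_mem_Ico hP 0 θ
    rw [zero_add] at h
    exact ⟨h.1, h.2.le⟩
  have hMθ : M θ = M θ' := by
    have hp : Function.Periodic M P := hMP
    rw [hθ', hp.sub_zsmul_eq]
  -- scale `x` to the unit sphere
  by_cases hx0 : x = 0
  · subst hx0; simp
  set s : ℝ := ∑ k, x k ^ 2 with hs
  have hspos : 0 < s :=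
    lt_of_le_of_ne (sum_sq_nonneg x) fun h ↦ hx0 ((sum_sq_eq_zero_iff x).1 h.symm)
  set c : ℝ := Real.sqrt s with hc
  have hcpos : 0 < c := Real.sqrt_pos.2 hspos
  have hcc : c ^ 2 = s := Real.sq_sqrt hspos.le
  set u : Fin 3 → ℝ := c⁻¹ • x with hu
  have huS : u ∈ S := by
    simp only [hS, mem_setOf_eq, hu, sum_sq_smul, inv_pow, hcc]
    exact inv_mul_cancel₀ hspos.ne'
  have hmem : (((θ', t), u) : (ℝ × ℝ) × (Fin 3 → ℝ)) ∈ K := ⟨⟨hθ'I, ht⟩, huS⟩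
  have hmin : f p₀ ≤ f ((θ', t), u) := hp₀min hmem
  have hfu : f ((θ', t), u) = c⁻¹ ^ 2 * ∑ k,
      ((((1 - t) • M θ + t • Matrix.diagonal ![(1 : ℝ), 1, -2]) *ᵥ x) k) ^ 2 := by
    simp only [hf, hA, hu, Matrix.mulVec_smul, sum_sq_smul, hMθ]
  rw [hfu] at hmin
  have hci : c⁻¹ ^ 2 = s⁻¹ := by rw [inv_pow, hcc]
  rw [hci] at hmin
  have := mul_le_mul_of_nonneg_left hmin hspos.le
  rw [← mul_assoc, mul_inv_cancel₀ hspos.ne', one_mul] at this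
  rw [mul_comm]
  exact this

end Literature.Analysis.Matrix

end
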